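import Literature.MathematicalPhysics.QuantumFieldTheory.Balaban1983to89.T3LogComparisonSocket
import HarnessLib

/-!
# Route `UnitScaleTilt` — crux K1bR-pr `FluctuationComparisonRegPr` (stmt-QuantumFields-19201), stub `stub_logComparisonRegPr`,
# layer S-E₀ «LEVELS»: the cut-off-Cauchy socket `PintCauchyAt` from its LEVEL-BY-LEVEL form `LevelCauchyAt`
# (support file `--supports stmt-QuantumFields-19201`; the stub stays open)

Fleet lead `ym-ust-19201-p2` (gen 0); split card `CARD-19201-logComparison-split.md` (evidence #16/#21), sub-lemma S-E, first layer: [King1986]'s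
replacement scheme read at the granularity of renormalisation steps.  Run `K` at comparison height `n` has `k = K − n` steps, run `K+1` has `k + 1`;
step `j` of run `K` is matched with step `j+1` of run `K+1` (same physical spacing `L^{j−K}`), step `0` of run `K+1` is the extra finest slice.
**`pintCauchyAt_of_levelwise`**: if `Pint K n = Σ_{j<K−n} P K j n` and `LevelCauchyAt F γ b₀ p₀ m P` (summable budgets `δ₀ K` for the extra slice and
`δ K j` for the matched pairs, constants `c₀ K`, `c K j`), then `PintCauchyAt F γ b₀ p₀ m Pint` with `r′_K := δ₀ K + Σ_{j<K−⌊K/m⌋} δ K j` and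
`c_K := c₀ K + Σ_{j<K−⌊K/m⌋} c K j` — `Finset.sum_range_succ'` (peel the extra slice), a.e. over finitely many `j` (`Filter.eventually_all_finset`),
`Finset.abs_sum_le_sum_abs`.  consumes (LINE №57): every clause of `LevelCauchyAt`.  WHAT THIS IS NOT: no estimate is asserted; `P` is an argument.

References: C. King, CMP 102 (1986) 649–677 [King1986] (Thm 3.4 (3.9) p.656; §3.4–3.6 pp.658–670, Props 3.8–3.10).
-/

noncomputable section

open MeasureTheory Filter Topology
open Literature.MathematicalPhysics.QuantumFieldTheory.Balaban1983to89
open Literature.MathematicalPhysics.QuantumFieldTheory.Balaban1983to89.T3ContinuumYM3Torus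
open Literature.MathematicalPhysics.QuantumFieldTheory.Balaban1983to89.T3UnitLawDensityEML (ℰp measurableE_ℰp)
open Literature.MathematicalPhysics.QuantumFieldTheory.Balaban1983to89.T3UnitScaleTilt
open Literature.MathematicalPhysics.QuantumFieldTheory.Balaban1983to89.T3TiltDescent
open Literature.MathematicalPhysics.QuantumFieldTheory.Balaban1983to89.T3LogComparisonSocket
open Literature.MathematicalPhysics.QuantumFieldTheory.Balaban1983to89.Missing

namespace Summit.QuantumFields.YangMills.Theorems.LogComparisonSocketLevels

/-- Telescoping the level decomposition (local helper): with `Σ' = Σ_{j<k+1} a′_j`, `Σ = Σ_{j<k} a_j`,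
`Σ' − Σ − (c₀ + Σ_{j<k} c_j) = (a′_0 − c₀) + Σ_{j<k} (a′_{j+1} − a_j − c_j)`. [folklore] -/
private theorem levels_telescope (k : ℕ) (a a' c : ℕ → ℝ) (c₀ : ℝ) :
    (∑ j ∈ Finset.range (k + 1), a' j) - (∑ j ∈ Finset.range k, a j) - (c₀ + ∑ j ∈ Finset.range k, c j) =
      (a' 0 - c₀) + ∑ j ∈ Finset.range k, (a' (j + 1) - a j - c j) := by
  rw [Finset.sum_range_succ']
  simp only [Finset.sum_sub_distrib]
  ring

/-- **`PintCauchyAt` FROM ITS LEVEL-BY-LEVEL FORM** ([King1986]'s replacement scheme at step granularity): for per-step data `P` with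
`Pint K n = Σ_{j<K−n} P K j n`, `LevelCauchyAt F γ b₀ p₀ m P ⇒ PintCauchyAt F γ b₀ p₀ m Pint`, radii `r′_K := δ₀ K + Σ_{j<K−⌊K/m⌋} δ K j`, constants
`c_K := c₀ K + Σ_{j<K−⌊K/m⌋} c K j`. [cite: King1986, Thm 3.4 (3.9) p.656] -/
theorem pintCauchyAt_of_levelwise (F : T3Family) (γ b₀ p₀ : ℝ) (m : ℕ)
    (P : (K j n : ℕ) → GaugeField (F.P n) 0 (Matrix.specialUnitaryGroup (Fin 2) ℂ) → ℝ)
    (Pint : (K n : ℕ) → GaugeField (F.P n) 0 (Matrix.specialUnitaryGroup (Fin 2) ℂ) → ℝ)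
    (hsum : ∀ (K n : ℕ) (V : GaugeField (F.P n) 0 (Matrix.specialUnitaryGroup (Fin 2) ℂ)), Pint K n V = ∑ j ∈ Finset.range (K - n), P K j n V)
    (h : LevelCauchyAt F γ b₀ p₀ m P) : PintCauchyAt F γ b₀ p₀ m Pint := by
  obtain ⟨δ, c, δ₀, c₀, hδ, hδ₀, hS, hextra, hmatch⟩ := h
  refine ⟨fun K => δ₀ K + ∑ j ∈ Finset.range (K - K / m), δ K j, fun K => c₀ K + ∑ j ∈ Finset.range (K - K / m), c K j, hS,
    fun K => add_nonneg (hδ₀ K) (Finset.sum_nonneg fun j _ => hδ K j), fun K => ?_⟩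
  -- finitely many a.e. statements at once
  have hm' : ∀ᵐ V ∂fieldMeasure (F.P (K / m)) 0 (Matrix.specialUnitaryGroup (Fin 2) ℂ), ∀ j ∈ Finset.range (K - K / m),
      PlaqSmall (θBal F.L γ b₀ p₀ (K / m)) V →
        0 < heightDensity F γ (Nat.div_le_self K m) (histGood F ℰp (θBal F.L γ b₀ p₀) K (K / m)) V →
        0 < heightDensity F γ ((Nat.div_le_self K m).trans (Nat.le_succ K))
              (histGood F ℰp (θBal F.L γ b₀ p₀) (K + 1) (K / m)) V →
          |P (K + 1) (j + 1) (K / m) V - P K j (K / m) V - c K j| ≤ δ K j :=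
    (Filter.eventually_all_finset _).mpr fun j hj => hmatch K j (Finset.mem_range.mp hj)
  filter_upwards [hextra K, hm'] with V h0V hjV hs h0 h0'
  have hk : K + 1 - K / m = K - K / m + 1 := Nat.succ_sub (Nat.div_le_self K m)
  rw [hsum, hsum, hk, levels_telescope]
  calc |P (K + 1) 0 (K / m) V - c₀ K + ∑ j ∈ Finset.range (K - K / m), (P (K + 1) (j + 1) (K / m) V - P K j (K / m) V - c K j)|
      ≤ |P (K + 1) 0 (K / m) V - c₀ K| + |∑ j ∈ Finset.range (K - K / m), (P (K + 1) (j + 1) (K / m) V - P K j (K / m) V - c K j)| :=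
        abs_add_le _ _
    _ ≤ δ₀ K + ∑ j ∈ Finset.range (K - K / m), δ K j := by
        refine add_le_add (h0V hs h0 h0') ((Finset.abs_sum_le_sum_abs _ _).trans (Finset.sum_le_sum fun j hj => ?_))
        exact hjV j hj hs h0 h0'

end Summit.QuantumFields.YangMills.Theorems.LogComparisonSocketLevels

end
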